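import Literature.Probability.RandomPlanarGeometry.DiscCycle
import HarnessLib

/-!
# The disc approximation `D^m ∈ 𝔇*` as a `USTPeano.Domain`

The lattice domain `discDomain m` (`m ≥ 12`) with `α = alphaPath m`, `β = betaPath m`,
`a = aIdx m`, `b = bIdx m` (`DiscPaths.lean`): the boundary polygon is simple and winds around
`0` (`DiscCycle.lean`); here we supply the last field of the structure, the orientation
condition `rightTestPt a ∈ D` ("`D` lies immediately to the right of `[α_a, β_a]`", [LSW04]
§4.1), by joining the test point `z₀ = (m - 3/8, -1/8)` to the inside point `0` with a segment
that misses the boundary polygon: every cyclic edge has both endpoints in one of six closed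
half-planes (`SepClass`: `im ≥ 1`, `re ≥ m`, `re ≤ -m`, `im ≤ -½`, `re - im ≥ m`,
`re + im ≤ -m`) each of which misses the segment `[z₀, 0]`.

* `rightTestPt_aIdx`, `sepClass_discVerts`, `disjoint_segment_of_sepClass`,
  `rightTestPt_mem_polygonDomain_discVerts`;
* `USTPeano.discDomain m hm : Domain` and its basic identities (`discDomain_carrier`, …);
  `zero_mem_discDomain`.
-/

noncomputable section

open Set Complex

namespace Literature.Probability.RandomPlanarGeometry

namespace USTPeano

variable {m : ℕ}

/-! ### The test point and the six separating half-planes -/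

/-- The orientation test point of `D^m` is `z₀ = (m - 3/8, -1/8)`. [folklore] -/
theorem rightTestPt_aIdx (m : ℕ) : rightTestPt (aIdx m) = ⟨(m : ℝ) - 3 / 8, -(1 / 8)⟩ := by
  rw [rightTestPt, peanoPt_aIdx, dualPt_dualNbr_aIdx, primalPt_primalNbr_aIdx]
  apply Complex.ext <;> simp <;> ring

/-- The six closed half-planes, one of which contains both endpoints of any cyclic edge of `D^m`.
[folklore] -/
def SepClass (m : ℕ) (u v : ℂ) : Prop :=
  (1 ≤ u.im ∧ 1 ≤ v.im) ∨ ((m : ℝ) ≤ u.re ∧ (m : ℝ) ≤ v.re) ∨ (u.re ≤ -m ∧ v.re ≤ -m) ∨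
    (u.im ≤ -(1 / 2) ∧ v.im ≤ -(1 / 2)) ∨ ((m : ℝ) ≤ u.re - u.im ∧ (m : ℝ) ≤ v.re - v.im) ∨
    (u.re + u.im ≤ -m ∧ v.re + v.im ≤ -m)

/-- A point of the closed segment `[z₀, 0]`, `z₀ = (m - 3/8, -1/8)`: it is `(1 - s) z₀`.
[folklore] -/
theorem mem_segment_rightTestPt {m : ℕ} {w : ℂ}
    (hw : w ∈ segment ℝ (⟨(m : ℝ) - 3 / 8, -(1 / 8)⟩ : ℂ) 0) :
    ∃ s ∈ Icc (0 : ℝ) 1, w.re = (1 - s) * ((m : ℝ) - 3 / 8) ∧ w.im = -(1 - s) / 8 := by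
  rw [segment_eq_image_lineMap] at hw
  obtain ⟨s, hs, rfl⟩ := hw
  refine ⟨s, hs, ?_, ?_⟩ <;> simp [AffineMap.lineMap_apply_module'] <;> ring

/-- **Each of the six half-planes misses the segment `[z₀, 0]`** (`m ≥ 1`), hence so does every
edge with both endpoints in one of them. [folklore] -/
theorem disjoint_segment_of_sepClass (hm : 1 ≤ m) {u v : ℂ} (h : SepClass m u v) :
    Disjoint (segment ℝ u v) (segment ℝ (⟨(m : ℝ) - 3 / 8, -(1 / 8)⟩ : ℂ) 0) := by
  have hmr : (1 : ℝ) ≤ m := by exact_mod_cast hm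
  rw [Set.disjoint_left]
  intro w hw hw'
  obtain ⟨s, hs, hre, him⟩ := mem_segment_rightTestPt hw'
  rw [segment_eq_image_lineMap] at hw
  obtain ⟨θ, hθ, rfl⟩ := hw
  simp only [AffineMap.lineMap_apply_module', Complex.add_re, Complex.add_im, Complex.real_smul,
    Complex.mul_re, Complex.ofReal_re, Complex.ofReal_im, zero_mul, sub_zero, Complex.mul_im,
    add_zero, Complex.sub_re, Complex.sub_im] at hre him
  rcases h with ⟨h1, h2⟩ | ⟨h1, h2⟩ | ⟨h1, h2⟩ | ⟨h1, h2⟩ | ⟨h1, h2⟩ | ⟨h1, h2⟩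
  · -- `im ≥ 1` but the segment has `im ≤ 0`
    nlinarith [hθ.1, hθ.2, hs.1, hs.2]
  · -- `re ≥ m` but the segment has `re ≤ m - 3/8`
    nlinarith [hθ.1, hθ.2, hs.1, hs.2]
  · -- `re ≤ -m` but the segment has `re ≥ 0`
    nlinarith [hθ.1, hθ.2, hs.1, hs.2]
  · -- `im ≤ -1/2` but the segment has `im ≥ -1/8`
    nlinarith [hθ.1, hθ.2, hs.1, hs.2]
  · -- `re - im ≥ m` but the segment has `re - im ≤ m - 1/4`
    nlinarith [hθ.1, hθ.2, hs.1, hs.2]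
  · -- `re + im ≤ -m` but the segment has `re + im ≥ 0`
    nlinarith [hθ.1, hθ.2, hs.1, hs.2]

/-- In the quarter, a vertex on the `x`-axis is `(m, 0)`. [folklore] -/
theorem fst_eq_of_mem_quarter_of_snd_eq_zero {p : ℤ × ℤ} (hp : p ∈ quarter m) (h0 : p.2 = 0) :
    p.1 = m := by
  obtain ⟨h1, h2, -, -, h5, -⟩ := mem_quarter_bounds hp
  rw [h0] at h5
  nlinarith

/-- **Every cyclic edge of `D^m` has both endpoints in one of the six half-planes** (`m ≥ 3`).
[folklore] -/
theorem sepClass_discVerts (hm : 3 ≤ m) (k : ℕ) (hk : k < (discVerts m).length) :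
    SepClass m ((discVerts m)[k])
      ((discVerts m)[(k + 1) % (discVerts m).length]'(Nat.mod_lt _ (by simp [discVerts]))) := by
  have hmr : (3 : ℝ) ≤ m := by exact_mod_cast hm
  refine boundaryVerts_cyclic' (R := SepClass m) (alphaPath_ne_nil m) (betaPath_ne_nil m)
    ?_ ?_ ?_ ?_ ?_ ?_ k hk
  · -- `a → α_a`: `re - im = m` for both
    rw [head_alphaPath (by omega), ← primalNbr_aIdx, peanoPt_aIdx, primalPt_primalNbr_aIdx]
    right; right; right; right; left
    simp
  · -- along `α`: `im ≥ 1` unless the step touches the `x`-axis, where `re = ±m`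
    have hq : (quarter m).IsChain fun p q ↦ UpLeft p q ∧ p ∈ quarter m ∧ q ∈ quarter m :=
      (isChain_upLeft_quarter (by omega)).imp_of_mem_imp fun x y hx hy h ↦ ⟨h, hx, hy⟩
    have key : ∀ p q : ℤ × ℤ, UpLeft p q → p ∈ quarter m → q ∈ quarter m →
        SepClass m (primalPt p) (primalPt q) ∧ SepClass m (primalPt (mirrorP q)) (primalPt (mirrorP p)) := by
      intro p q h hp hq'
      obtain ⟨hp1, -, hp3, -⟩ := mem_quarter_bounds hp
      rcases h with ⟨rfl, h1⟩ | ⟨rfl, h1⟩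
      · -- up-step in column `x`: if `y ≥ 1` then `im ≥ 1`; if `y = 0` then `x = m`
        rcases hp3.eq_or_lt with h0 | h0
        · have hx := fst_eq_of_mem_quarter_of_snd_eq_zero hp h0.symm
          constructor
          · right; left; simp [hx]
          · right; right; left; simp [mirrorP, hx]
        · have h0' : (1 : ℝ) ≤ p.2 := by exact_mod_cast (show 1 ≤ p.2 by omega)
          constructor
          · left
            simp only [primalPt_im, Int.cast_add, Int.cast_one]
            constructor <;> linarith
          · left
            simp only [mirrorP, primalPt_im, Int.cast_add, Int.cast_one]
            constructor <;> linarith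
      · -- left-step at height `y ≥ 1`
        have h1' : (1 : ℝ) ≤ p.2 := by exact_mod_cast h1
        constructor
        · left
          simp only [primalPt_im]
          exact ⟨h1', h1'⟩
        · left
          simp only [mirrorP, primalPt_im]
          exact ⟨h1', h1'⟩
    rw [alphaPath, List.isChain_append]
    refine ⟨?_, ?_, ?_⟩
    · exact hq.imp fun p q h ↦ (key p q h.1 h.2.1 h.2.2).1
    · rw [List.isChain_map]
      exact (List.isChain_reverse.2 (hq.imp fun p q h ↦ (key p q h.1 h.2.1 h.2.2).2)).tail
    · intro p hp q hq''
      rw [List.getLast?_eq_getLast_of_ne_nil (quarter_ne_nil m), Option.mem_def,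
        Option.some.injEq, getLast_quarter] at hp
      subst hp
      have hq3 : q = (-1, (m : ℤ)) := by
        rw [quarter_eq (by omega)] at hq''
        simp at hq''
        rw [← hq'']
      subst hq3
      left
      simp only [primalPt_im, Int.cast_natCast]
      constructor <;> linarith
  · -- `α_b → b`: `re + im = -m`
    rw [getLast_alphaPath (by omega), ← primalNbr_bIdx, primalPt_primalNbr_bIdx, peanoPt_bIdx]
    right; right; right; right; right
    simp
  · -- `b → β_b`
    rw [getLast_betaPath hm, ← dualNbr_bIdx, peanoPt_bIdx, dualPt_dualNbr_bIdx]
    right; right; right; right; right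
    constructor <;> simp
  · -- along `β`: all dual points have `im ≤ -1/2`
    rw [List.isChain_iff_getElem]
    intro i hi
    have hu := mem_betaPath_bounds (show 1 ≤ m by omega) (List.getElem_mem (by omega : i < (betaPath m).length))
    have hv := mem_betaPath_bounds (show 1 ≤ m by omega) (List.getElem_mem hi)
    right; right; right; left
    simp only [dualPt_im]
    have h1 : (((betaPath m)[i + 1]).2 : ℝ) ≤ -1 := by exact_mod_cast hv.2.2.2.1
    have h2 : (((betaPath m)[i]).2 : ℝ) ≤ -1 := by exact_mod_cast hu.2.2.2.1
    constructor <;> linarith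
  · -- `β_a → a`: `re - im = m`
    rw [head_betaPath (by omega), ← dualNbr_aIdx, dualPt_dualNbr_aIdx, peanoPt_aIdx]
    right; right; right; right; left
    simp

/-- **The orientation test point lies inside the polygon of `D^m`** (`m ≥ 12`): the segment from
`z₀` to `0` misses the polygon and `0` is inside. [folklore] -/
theorem rightTestPt_mem_polygonDomain_discVerts (hm : 12 ≤ m) :
    rightTestPt (aIdx m) ∈
      (polygonDomain (discVerts m) (isSimpleClosedPolygon_discVerts hm)).carrier := by
  set z₀ : ℂ := ⟨(m : ℝ) - 3 / 8, -(1 / 8)⟩ with hz₀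
  rw [rightTestPt_aIdx]
  have h0 := zero_mem_polygonDomain_discVerts hm
  -- the segment misses the polygon
  have hdisj : segment ℝ z₀ 0 ⊆ (range (polygonLoop (discVerts m)))ᶜ := by
    intro w hw hw'
    rw [← frontier_polygonDomain_eq_range _ (isSimpleClosedPolygon_discVerts hm),
      frontier_polygonDomain, mem_iUnion] at hw'
    obtain ⟨k, hk⟩ := hw'
    exact Set.disjoint_left.1 (disjoint_segment_of_sepClass (by omega)
      (sepClass_discVerts (by omega) k k.2)) hk hw
  exact JordanDomain.subset_ofLoop_carrier _ _ _ (convex_segment _ _).isPreconnected hdisj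
    (right_mem_segment _ _ _) h0 (left_mem_segment _ _ _)

/-! ### The domain -/

/-- **The grid approximation `D^m = D(α^m, β^m, a^m, b^m) ∈ 𝔇*` of the disc of radius `m`**
(`m ≥ 12`), with `a^m = (m - ¼, -¼)` near `m · 1` and `b^m = (-m + ¼, -¼)` near `m · (-1)`: the
approximations of `(R𝔻, Rα_𝔻, Rβ_𝔻)` for `SmoothDomain.unitDisc` at the integer scales `R = m`
([LSW04] §4.3). [cite: LawlerSchrammWerner2004, §4.3] -/
def discDomain (m : ℕ) (hm : 12 ≤ m) : Domain where
  α := alphaPath m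
  β := betaPath m
  a := aIdx m
  b := bIdx m
  α_ne_nil := alphaPath_ne_nil m
  β_ne_nil := betaPath_ne_nil m
  isChain_α := isChain_latticeAdj_alphaPath (by omega)
  isChain_β := isChain_latticeAdj_betaPath (by omega)
  head_α := (head_alphaPath (by omega)).trans (primalNbr_aIdx m).symm
  head_β := (head_betaPath (by omega)).trans (dualNbr_aIdx m).symm
  getLast_α := (getLast_alphaPath (by omega)).trans (primalNbr_bIdx m).symm
  getLast_β := (getLast_betaPath (by omega)).trans (dualNbr_bIdx m).symm
  simple := isSimpleClosedPolygon_discVerts hm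
  rightTestPt_mem := rightTestPt_mem_polygonDomain_discVerts hm

/-- The carrier of `D^m` is the inside of its boundary polygon. [folklore] -/
theorem discDomain_carrier (hm : 12 ≤ m) :
    (discDomain m hm).carrier =
      (polygonDomain (discVerts m) (isSimpleClosedPolygon_discVerts hm)).carrier := rfl

/-- `0 ∈ D^m`. [folklore] -/
theorem zero_mem_discDomain (hm : 12 ≤ m) : (0 : ℂ) ∈ (discDomain m hm).carrier :=
  zero_mem_polygonDomain_discVerts hm

/-- The wired path of `D^m`. [folklore] -/
@[simp] theorem discDomain_α (hm : 12 ≤ m) : (discDomain m hm).α = alphaPath m := rfl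

/-- The free path of `D^m`. [folklore] -/
@[simp] theorem discDomain_β (hm : 12 ≤ m) : (discDomain m hm).β = betaPath m := rfl

end USTPeano

end Literature.Probability.RandomPlanarGeometry
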